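import Summits.QuantumAdvantage.QuantumAdvantage.Theorems.NearExactIsExact.Negative.AffineDigitCaseAFourteen
import Summits.QuantumAdvantage.QuantumAdvantage.Theorems.CubicForrelationNearExactIsExactAffineForm

/-!
# The digit of a case-A type-O cubic on 14 bits is not affine (frame-free)
# (THEOREM CA-W, Step 1, rank 0; NearExactIsExact, disprover gen 23)

Negative/structural lemma for the crux `CubicForrelation.NearExactIsExact` (item r2), finite slice `n = 14`;
ONE-SIDED and FRAME-FREE.  HONEST FRAMING: a theorem about a single cubic Boolean function on 14 bits — NOT summit
progress; no violation of `NearExactIsExact`, no per-`n` value.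

`caseA_digit_not_affine`: for a cubic `g` on `14` bits with `W_g = 32u`, all `u(x)` odd and
`[⌊u/2⌋ odd] ≠ [⌊u/4⌋ odd]` everywhere, the digit `d₁ = [⌊u/2⌋ odd]` is NOT of algebraic degree `≤ 1`.
Proof: a degree-`≤ 1` Boolean function is an affine character `(−1)^{d₁} = (−1)^b (−1)^{c·a}` (tree:
`stub_affineForm`), which is the affine normal form excluded by `AffineDigitCaseAFourteen.affine_digit_caseA_false`.
With `CaseARankTwoFourteen.caseA_radical_large` (rank `≤ 2`) this says: the digit quadratic of a case-A type-O cubic on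
14 bits has symplectic rank EXACTLY `2`.

Sources: [this work]; affine form of degree-1 functions [cite Carlet2020 §2.2] via `stub_affineForm`.  Standard axioms only.
-/

set_option linter.dupNamespace false -- D-0017: single-problem summit ⇒ `QuantumAdvantage.QuantumAdvantage` by design

noncomputable section

namespace Summit.QuantumAdvantage.QuantumAdvantage.Theorems.NearExactIsExact.Negative.CaseADigitNotAffineFourteen

open Finset
open Literature.Computability.QuantumComplexity
open Literature.Computability.QuantumComplexity.DerivativeWalsh (W)
open Summit.QuantumAdvantage.QuantumAdvantage.Theorems.CubicForrelation.NearExactIsExact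
open Summit.QuantumAdvantage.QuantumAdvantage.Theorems.NearExactIsExact.Negative.AffineDigitCaseAFourteen
  (affine_digit_caseA_false)

/-- **THEOREM CA-W, Step 1, rank 0 (frame-free): the case-A digit is not affine.** For a cubic `g` on `14` bits with
`W_g = 32u`, all `u(x)` odd and `[⌊u/2⌋ odd] ≠ [⌊u/4⌋ odd]` everywhere, `a ↦ [⌊u(a)/2⌋ odd]` does not have degree `≤ 1`.
ONE-SIDED; NOT summit progress. [this work] -/
theorem caseA_digit_not_affine (g : (Fin (7 + 7) → Bool) → Bool) (hg : IsDegLeFun 3 g)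
    (u : (Fin (7 + 7) → Bool) → ℤ) (hu : ∀ x, W (fun y => signOf (g y)) x = (2 : ℝ) ^ 5 * (u x : ℝ))
    (hodd : ∀ x, Odd (u x)) (hA : ∀ x, ¬ (Odd (u x / 2) ↔ Odd (u x / 2 / 2))) :
    ¬ IsDegLeFun 1 (fun a => decide (Odd (u a / 2))) := by
  intro h1
  obtain ⟨c, b, hcb⟩ := stub_affineForm (7 + 7) _ h1
  refine affine_digit_caseA_false g hg u hu hodd hA c b fun a => ?_
  have h : signOf (decide (Odd (u a / 2))) = signOf b * twist c a := hcb a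
  rcases tc_twist_cases c a with ht | ht
  · rw [ht, mul_one] at h
    by_cases ho : Odd (u a / 2)
    · rw [decide_eq_true ho] at h
      cases b
      · norm_num [signOf] at h
      · exact iff_of_true ho (iff_of_true ht rfl)
    · rw [decide_eq_false ho] at h
      cases b
      · exact iff_of_false ho fun hh => Bool.false_ne_true (hh.1 ht)
      · norm_num [signOf] at h
  · rw [ht] at h
    by_cases ho : Odd (u a / 2)
    · rw [decide_eq_true ho] at h
      cases b
      · exact iff_of_true ho (iff_of_false (by rw [ht]; norm_num) Bool.false_ne_true)
      · norm_num [signOf] at h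
    · rw [decide_eq_false ho] at h
      cases b
      · norm_num [signOf] at h
      · exact iff_of_false ho fun hh => absurd (hh.2 rfl) (by rw [ht]; norm_num)

end Summit.QuantumAdvantage.QuantumAdvantage.Theorems.NearExactIsExact.Negative.CaseADigitNotAffineFourteen

end
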